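/-
Copyright: lit-balaban cell, Phase-2 proof seat p11 (gen 5).  Statement-level skeleton of a published paper; no proof claims beyond
what the kernel checks below.
-/
import Literature.MathematicalPhysics.QuantumFieldTheory.BalabanImbrieJaffe1984to88.BIJ85Ineq732General

/-!
# `BalabanImbrieJaffe1984to88.BIJ85Claim73Smooth` — T. Bałaban, J. Imbrie, A. Jaffe, *Renormalization of the Higgs model:
minimizers, propagators and the stability of mean field theory*, Commun. Math. Phys. **97** (1985) 299–329
[BalabanImbrieJaffe1985]: Sect. 7.3 p. 326 — r15's TYPED CLAIM `BIJ85Sect7Statements.ScalarStabData.Claim73` ("for constants γ > 0,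
α > 0, M < ∞: (7.3.1) ⇒ (7.3.2)") INHABITED FOR THE FAMILY OF ALL `η`-SMOOTH `U(1)` BACKGROUNDS: every torus of dimension `d`, every
level `k ≥ 1`, EVERY `U(1)` field `u` on the `η`-lattice and every `0 < e_k ≤ 1`, with (7.3.1) read on the `η`-lattice plaquettes of the
background — `L^{2k}|u(∂p) − 1| ≤ e_k𝓅(e_k)`, `𝓅(e) = (1 + ln e^{−1})^𝓅` — and the conclusion (7.3.2) (first printed form, `u_k(b)` = the
transport of `u` along `b`) with `γ = min(a/(9(d+1)), 1/12)`, `α = ½`, `M = (4/3)d⁴(1+4𝓅₊)^{2𝓅₊}`, uniform in `k`, `L`, the volume and the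
background.  File 5 (last) of the general-background member of SKELETON row **C1.Eq7.3.1-7.3.2** (seat p11 gen 5; files 1–4
`BIJ85AbelianStokes`, `BIJ85HolonomyDefect`, `BIJ85CovariantPoincare`, `BIJ85Ineq732General`); the flat family is gen 4's `claim73_flat`,
the pull-back family `BIJ85Ineq732PullBack.claim73_pullBack`.

RELATION TO p33 g6's `claim73_background` / `claim73_backgroundP` / `claim73_actual` (same row, landed meanwhile): those inhabit `Claim73`
for index families of (4.5.4)-SHAPED backgrounds `Q^{s*}_k v·e^{iθ}` (bondwise small phase; the last one composed with (7.3.1) modulo the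
`ℓ^∞` property of `𝒟_k∂^*Q^{e*}_k`); the family here is indexed by ARBITRARY `U(1)` backgrounds and the hypothesis is the gauge-invariant
plaquette bound read as (7.3.1) at the scale `η`.

statement-level skeleton of published theorems with citation tags; proofs where landed; nothing here is a claim about the Yang–Mills mass gap

PDF held: `paper:balaban1985-cmp97-bij-higgs-minimizers` (journal page = PDF page + 298).  Pages read this session (`lit read`, OCR text):
p. 325–326 [PDF 27–28].

CITATION HEADER (lean-in-tree rule).  Phase-2 file of the lit-balaban TYPED SKELETON (HOME `run/shared/lean/pub/lit-balaban/`), seat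
p11 gen 5 (unit `lit-balaban-p11-g5`; TAKING line HOME/STATUS.md 2026-08-21T10:52:36Z; owner r15, referee ref-5; free-target protocol
G.5-34(d), own lane).  WHAT IS REPRODUCED: SKELETON row **C1.Eq7.3.1-7.3.2** (`typed p239582`, r15: *"NO printed proof — 'extension of the
proofs of [7]' = B4"*): the typed carrier's `Claim73 𝓅 fam` for a family of GENERAL (non-flat, non-pull-back) backgrounds.

THE PRINTED TEXT, verbatim (p. 326 [PDF 28]): *"In particular, let us assume that for the unit lattice field v, |v(∂p) − 1| ≤ e_k𝓅(e_k),
(7.3.1) where 𝓅(e_k) = (1 + ln e_k^{−1})^𝓅. Then the stability estimate can be stated in two forms. For constants γ > 0, α > 0, M < ∞,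
⟨φ, Δ_k(u_k)φ⟩ ≥ γ Σ_{b∈T₁^{(k)}} |u_k(b)φ(b₊) − φ(b₋)|² − Me_k^{2−α} Σ_{x∈T₁^{(k)}} |φ(x)|². (7.3.2)"*

WHAT IS PROVED HERE (0 `sorry`, standard axioms).
* `SmoothIdx d`, `smoothG`, `smoothStabData a` — the MODEL INSTANCE of r15's carrier `ScalarStabData` at an `η`-smooth background: `Plaq` = the
  `η`-lattice plaquettes of `T^{(j)}` with `plaqDev p := L^{2k}‖u(∂p) − 1‖`; bonds / sites / scalar fields of the unit lattice `T₁^{(k)}`;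
  `covDiffSq ψ b = |u_k(b)ψ(b₊) − ψ(b₋)|²` (`u_k = lineIter u k`); `absSq ψ x = |ψ(x)|²`; `deltaForm ψ = ⟨ψ, Δ_k(u)ψ⟩` with the printed `a_k`, the
  physical normalization `cPhys` and THE inverse `G_k(u)` of (4.6.2) (`exists_GK`); `ek = e_k`.
* **`ineq732_smoothStabData`**, **`claim73_smooth`**: `Hyp731 𝓅 ⇒ Ineq732 γ ½ M` at every index, hence `Claim73 𝓅 (smoothStabData a)` — from file 4's
  `ineq732_general_phys` (error `(4/3)d⁴(L^{2k}θ)²‖ψ‖²` at plaquette deviation `θ`) with `θ = e_k𝓅(e_k)L^{−2k}` and `sq_hyp731_le`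
  (`(e𝓅(e))² ≤ (1+4𝓅₊)^{2𝓅₊}e^{3/2}`).
HONEST SCOPE.  (1) (7.3.1) is read on the `η`-lattice plaquettes of the background `u`; the paper states it for the unit-lattice field `v` from
which `u_k` is built by (4.5.4) — the passage (regularity of the minimizers, Sect. 7.2 / [6I] Prop. 1.2) is NOT claimed (HOME/GAPS.md G-C1-05,
narrowed to exactly this).  (2) `0 < e_k ≤ 1` (the regime of the paper; for `e_k > 1` the printed base `1 + ln e_k^{−1}` is `< 1`).  (3) First
printed form only.  (4) Constants not optimized.
-/

open scoped RealInnerProductSpace BigOperators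
open Finset

namespace Literature.MathematicalPhysics.QuantumFieldTheory.BalabanImbrieJaffe1984to88.BIJ85Claim73Smooth

open Literature.MathematicalPhysics.QuantumFieldTheory.Balaban1983to89
open BIJ88Sect3Statements (U1 toC toC_one toC_mul norm_toC)
open BIJ85Sect1Model (HiggsField)
open BIJ85BlockAveragesTorus BIJ85BlockAveragesTorusK BIJ85ScalarPropagatorTorus BIJ85ScalarPropagatorTorusK
open BIJ85ScalarForm464 BIJ85Eq461Proof BIJ85BlockAveragingIneq BIJ85Ineq732Flat
open BIJ85AbelianStokes BIJ85HolonomyDefect BIJ85CovariantPoincare BIJ85Ineq732General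

noncomputable section

/-! ## §1 The family of `η`-smooth backgrounds as instances of r15's carrier -/

/-- Index of the family of `η`-SMOOTH BACKGROUNDS of Sect. 7.3: any parameters `P` of dimension `d`, any levels `j`, `k ≥ 1` in the standing
range, ANY `U(1)` field `u` on the `η`-lattice `T^{(j)}`, and the coupling `0 < e_k ≤ 1` of (7.3.1). [cite: BalabanImbrieJaffe1985, (7.3.1) p.326] -/
structure SmoothIdx (d : ℕ) where
  P : Params
  hd : P.d = d
  j : ℕ
  k : ℕ
  hk1 : 1 ≤ k
  hk : j + k ≤ P.m + P.K
  U : GaugeField P j U1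
  e : ℝ
  he : 0 < e
  he1 : e ≤ 1

/-- kernel: the printed `a_k > 0` at an index. [cite: BalabanImbrieJaffe1985, (4.6.4) p.313] -/
theorem SmoothIdx.aK_pos {d : ℕ} (i : SmoothIdx d) {a : ℝ} (ha : 0 < a) : 0 < BIJ85Sect4Statements.aK a i.P.L i.k :=
  (BIJ85CoefficientAk464.aK_pos_le ha (by linarith [three_le_L i.P]) i.hk1).1

/-- `G_k(u) = [−Δ_u + a_kQ_k(u)^*Q_k(u)]^{−1}` at an index: THE inverse of (4.6.2) at the background `u` (it exists for every `u` and is two-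
sided, gen 3's `exists_GK`; chosen by `Classical.choose`). [cite: BalabanImbrieJaffe1985, (4.6.2) p.313] -/
def smoothG {d : ℕ} (a : ℝ) (ha : 0 < a) (i : SmoothIdx d) : FineSp i.P i.j →ₗ[ℝ] FineSp i.P i.j :=
  Classical.choose (exists_GK i.hk (cPhys_pos i.P i.k).ne' (i.aK_pos ha) i.U)

/-- kernel: `smoothG` is a right inverse of `D_u^*D_u + a_kQ_k(u)^*Q_k(u)`. [cite: BalabanImbrieJaffe1985, (4.6.2) p.313] -/
theorem smoothG_spec {d : ℕ} (a : ℝ) (ha : 0 < a) (i : SmoothIdx d) (φ : FineSp i.P i.j) :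
    opT (Dlin (cPhys i.P i.k) i.U) (QlinK i.U i.k) (BIJ85Sect4Statements.aK a i.P.L i.k) (smoothG a ha i φ) = φ :=
  (Classical.choose_spec (exists_GK i.hk (cPhys_pos i.P i.k).ne' (i.aK_pos ha) i.U)).1 φ

/-- **The MODEL INSTANCE of r15's Sect. 7.3 carrier at an `η`-smooth background** `i`: plaquettes = the `η`-LATTICE plaquettes of `T^{(j)}`
with `plaqDev p := L^{2k}·‖u(∂p) − 1‖` (the deviation measured at the unit scale `η^{−2}`); bonds and sites of the unit lattice `T₁^{(k)} =
T^{(j+k)}`; scalar fields `ψ ∈ ℓ²(T₁^{(k)})`; `covDiffSq ψ b = |u_k(b)ψ(b₊) − ψ(b₋)|²` with `u_k(b)` the transport of `u` along `b`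
(`lineIter u k`, first printed form); `absSq ψ x = |ψ(x)|²`; `deltaForm ψ = ⟨ψ, Δ_k(u)ψ⟩` with the printed `a_k`, the physical normalization
and `G_k(u) = smoothG`; `ek = e`. [cite: BalabanImbrieJaffe1985, (7.3.2) p.326] -/
def smoothStabData {d : ℕ} (a : ℝ) (ha : 0 < a) (i : SmoothIdx d) : BIJ85Sect7Statements.ScalarStabData where
  Plaq := Balaban1983to89.Plaq i.P i.j
  Bond := PBond i.P (i.j + i.k)
  Site := Balaban1983to89.Site i.P (i.j + i.k)
  Scalar := CoarseSpK i.P i.j i.k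
  ek := i.e
  plaqDev := fun p => ((i.P.L : ℝ) ^ i.k) ^ 2 * ‖toC (GaugeField.plaqHol i.U p) - 1‖
  covDiffSq := fun ψ b => ‖toC (lineIter i.U i.k b) * ψ b.tgt - ψ b.src‖ ^ 2
  absSq := fun ψ x => ‖ψ x‖ ^ 2
  deltaForm := fun ψ => ⟪ψ, deltaOp (QlinK i.U i.k) (BIJ85Sect4Statements.aK a i.P.L i.k) (smoothG a ha i) ψ⟫

/-! ## §2 `Hyp731 ⇒ Ineq732` at every index, and `Claim73` -/

/-- kernel: at an index satisfying `Hyp731 𝓅` all (oriented) `η`-plaquette variables of `u` are within `θ = e𝓅(e)/L^{2k}` of `1`.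
[cite: BalabanImbrieJaffe1985, (7.3.1) p.326] -/
theorem theta_of_hyp731 {d : ℕ} (a : ℝ) (ha : 0 < a) (i : SmoothIdx d) (pexp : ℝ)
    (h : (smoothStabData a ha i).Hyp731 pexp) (x : Balaban1983to89.Site i.P i.j) (μ ν : Fin i.P.d) :
    ‖plaqC i.U x μ ν - 1‖ ≤ i.e * (1 + Real.log i.e⁻¹) ^ pexp / ((i.P.L : ℝ) ^ i.k) ^ 2 := by
  have hn2 : (0 : ℝ) < ((i.P.L : ℝ) ^ i.k) ^ 2 := pow_pos (pow_pos (Nat.cast_pos.2 i.P.L_pos) _) _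
  have hP : ∀ p : Balaban1983to89.Plaq i.P i.j,
      ‖toC (GaugeField.plaqHol i.U p) - 1‖ ≤ i.e * (1 + Real.log i.e⁻¹) ^ pexp / ((i.P.L : ℝ) ^ i.k) ^ 2 := by
    intro p
    rw [le_div_iff₀ hn2, mul_comm]
    exact h p
  have hθ0 : 0 ≤ i.e * (1 + Real.log i.e⁻¹) ^ pexp / ((i.P.L : ℝ) ^ i.k) ^ 2 := by
    have hb : 0 ≤ 1 + Real.log i.e⁻¹ := by
      have := Real.log_nonneg ((one_le_inv₀ i.he).2 i.he1); linarith
    exact div_nonneg (mul_nonneg i.he.le (Real.rpow_nonneg hb _)) hn2.le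
  exact norm_plaqC_sub_one_le_of_plaqHol i.U hθ0 hP x μ ν

/-- **r15's typed (7.3.2) `Ineq732 γ α M` at every `η`-smooth index under `Hyp731 𝓅`**, with `γ = min(a/(9(d+1)), 1/12)`, `α = ½`,
`M = (4/3)d⁴(1+4𝓅₊)^{2𝓅₊}`. [cite: BalabanImbrieJaffe1985, (7.3.2) p.326] -/
theorem ineq732_smoothStabData {d : ℕ} (a : ℝ) (ha : 0 < a) (pexp : ℝ) (i : SmoothIdx d)
    (h : (smoothStabData a ha i).Hyp731 pexp) :
    (smoothStabData a ha i).Ineq732 (min (a / (9 * (d + 1))) (1 / 12)) (1 / 2)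
      (4 / 3 * (d : ℝ) ^ 4 * (1 + 4 * max pexp 0) ^ (2 * max pexp 0)) := by
  intro ψ
  change CoarseSpK i.P i.j i.k at ψ
  have hd' : (i.P.d : ℝ) = d := by rw [i.hd]
  have hn2 : (0 : ℝ) < ((i.P.L : ℝ) ^ i.k) ^ 2 := pow_pos (pow_pos (Nat.cast_pos.2 i.P.L_pos) _) _
  have hθ := theta_of_hyp731 a ha i pexp h
  have hmain := ineq732_general_phys i.hk1 i.hk ha i.U hθ (smoothG_spec a ha i) ψ
  have es : ((i.P.L : ℝ) ^ i.k) ^ 2 * (i.e * (1 + Real.log i.e⁻¹) ^ pexp / ((i.P.L : ℝ) ^ i.k) ^ 2)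
      = i.e * (1 + Real.log i.e⁻¹) ^ pexp := by
    rw [← mul_div_assoc, mul_div_cancel_left₀ _ hn2.ne']
  rw [es, hd', ← sum_norm_sq_eq ψ] at hmain
  have hS : 0 ≤ ∑ x : Balaban1983to89.Site i.P (i.j + i.k), ‖ψ x‖ ^ 2 := sum_nonneg fun _ _ => by positivity
  have hd4 : (0 : ℝ) ≤ 4 / 3 * (d : ℝ) ^ 4 := by positivity
  have hcmp := mul_le_mul_of_nonneg_right (mul_le_mul_of_nonneg_left (sq_hyp731_le pexp i.he i.he1) hd4) hS
  show min (a / (9 * (d + 1))) (1 / 12) * bondForm (lineIter i.U i.k) ψ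
      - 4 / 3 * (d : ℝ) ^ 4 * (1 + 4 * max pexp 0) ^ (2 * max pexp 0) * i.e ^ (2 - 1 / 2 : ℝ)
          * ∑ x : Balaban1983to89.Site i.P (i.j + i.k), ‖ψ x‖ ^ 2
      ≤ ⟪ψ, deltaOp (QlinK i.U i.k) (BIJ85Sect4Statements.aK a i.P.L i.k) (smoothG a ha i) ψ⟫
  linarith

/-- **r15's typed claim of Sect. 7.3, `ScalarStabData.Claim73 𝓅 fam` — "for constants γ > 0, α > 0, M < ∞ (chosen before k and the
configuration), (7.3.1) ⇒ (7.3.2)" — PROVED FOR THE FAMILY OF ALL `η`-SMOOTH BACKGROUNDS** `smoothStabData a` over `SmoothIdx d` (any `d`,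
`a > 0`, any exponent `𝓅`): every torus of dimension `d`, every `k ≥ 1` in range, EVERY `U(1)` field `u` on the `η`-lattice, every `0 < e_k ≤ 1`;
(7.3.1) read on the `η`-lattice plaquettes of the background (`L^{2k}|u(∂p) − 1| ≤ e_k𝓅(e_k)`); `γ = min(a/(9(d+1)), 1/12)`, `α = ½`,
`M = (4/3)d⁴(1+4𝓅₊)^{2𝓅₊}`, uniform in `k`, `L`, the volume and the background.  HONEST SCOPE: the passage from the printed (7.3.1) on the
unit-lattice field `v` to this `η`-scale form for the background `u_k` of (4.5.4) is the Sect. 7.2 regularity input, not claimed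
(HOME/GAPS.md G-C1-05). [cite: BalabanImbrieJaffe1985, (7.3.1)–(7.3.2) p.326] -/
theorem claim73_smooth {d : ℕ} (a : ℝ) (ha : 0 < a) (pexp : ℝ) :
    BIJ85Sect7Statements.ScalarStabData.Claim73 pexp (smoothStabData (d := d) a ha) :=
  ⟨min (a / (9 * (d + 1))) (1 / 12), 1 / 2, 4 / 3 * (d : ℝ) ^ 4 * (1 + 4 * max pexp 0) ^ (2 * max pexp 0),
    lt_min (by positivity) (by norm_num), by norm_num, fun i hi => ineq732_smoothStabData a ha pexp i hi⟩

end

end Literature.MathematicalPhysics.QuantumFieldTheory.BalabanImbrieJaffe1984to88.BIJ85Claim73Smooth
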